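import Summits.BirchSwinnertonDyer.BirchSwinnertonDyer.Theses.PrintX11a
import Summits.BirchSwinnertonDyer.BirchSwinnertonDyer.Theses.ErratumRoadFive
import Summits.BirchSwinnertonDyer.BirchSwinnertonDyer.Theorems.ErratumRoadFiveNonSurjCornerTwinKatoEngine
import Literature.NumberTheory.EllipticCurves.HidaFamilyMembers
import Literature.NumberTheory.EllipticCurves.PadicSeriesEvaluation
import Literature.NumberTheory.EllipticCurves.PeriodRationality
import Literature.NumberTheory.EllipticCurves.Greenberg1999.SelmerCotorsionMultiplicative
import HarnessLib

/-!
# Line «wttransv5» for crux U5 = `PrintX11a.UpperNonSurjFive` (item `stmt-BirchSwinnertonDyer-20614`)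

bsd-idea-6 g17, lens «decomp», CRUX-LEVEL ONLY (D-0152 ∕ W-71; W-79 publish-only: PUBLISHED with `ledger crux write`, never `skeleton check`ed —
the line of record stays «gl1cartan5» rev 12).  BSD is not proved by any of this; nothing is asserted about any curve; the crux does NOT
close (two `sorry`s, both inside `stub_*`); the composition `UpperNonSurjFive_of_wttransv` is a real proof applying the stubs BY NAME.

## Idea — THE WEIGHT-VARIABLE TRANSVECTION (Λ-adic unipotent of the Hida family) and Ochiai's two-variable Euler-system bound

On U5 (`ClassX11a ∧ ¬Surj ∧ p ≥ 5`: `p ∈ {5,7}`, image `5Ns(32)/5S4(96)/7Ns(72)`, of order PRIME TO `p`) every Euler-system or Kolyvagin-system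
integrality argument for `T_pE` is dead: `ρ̄_{E,p}(G_ℚ)` has no element of order `p`, so no `τ` acts on `E[p]` as a transvection (barrier
`EulerSystemBigImageAtSmallImage`; HOME HANDOFF l.268).  Consequence used here: `E[p]|G_{ℚ_p}` is SPLIT, `μ_p ⊕ ℤ/p` up to the unramified
quadratic twist — equivalently the Tate period `q_E ∈ (ℚ_p^×)^p`, so `ρ̄` is finite at `p` and the Kummer class `c_q` of `q_E` is `p^a·(unit)`,
`a ≥ 1`, in `H¹(ℚ_p, ℤ_p(1))`.
THE LEVER: pass to the Hida family.  Let `𝕀` be the branch of the ordinary Hecke algebra of tame level `N/p` through the `p`-NEW weight-2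
point `x_E` (`U_p ↦ a_p(E) = ±1`), `𝕋` its big Galois representation, `M_∞ = ℚ_p^{nr}(μ_{p^∞})`.  In an `𝕀`-basis adapted to the ordinary
filtration every `τ ∈ G_{M_∞}` acts as the unipotent `(1, P_τ; 0, 1)`, `P_τ ∈ 𝕀`, and `P_τ(x_E)` is the `τ`-component of `c_q`; choosing `τ`
with `c_q(τ) ≠ 0` gives `P_τ ≠ 0`: **the family HAS the transvection that `E[p]` lacks** — Ochiai's condition (i) of [Ochiai2006, Thm 2]
holds at EVERY U5 pair ((ii) `−1 ∈ ρ̄(G_ℚ)` holds for the three images; (Ir) holds).  Ochiai's Theorem 2 ∕ 3(ii) (Kato's Λ-adic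
Beilinson–Kato Euler system over the two-variable algebra `A₂ = 𝕀⟦Γ⟧`) then bounds, for EVERY height-one prime `𝔮` of `A₂`
(including `𝔮 ∋ p`):  `length_𝔮 Sel_𝕋^∨ ≤ ord_𝔮 L_p^{Ki} + m · ord_𝔮 P_τ`  — a two-variable main-conjecture divisibility WITH THE
UNIPOTENT LOSS `P_τ^m`.  [corpus: paper:ochiai2006-two-variable-iwasawa-main-conjecture p.7–8 (Thm 1, Thm 2, Lemma 2.6, Thm 3), p.33 (Cor 7.5, Rem 7.6)]
THE NEW CRUX (β, «corner unit»): `π ∤ P_τ` for some `τ` ⟺ the mod-`p` Hida family `𝕋 ⊗ 𝕀/π` restricted to `G_{ℚ_p}` is NON-SPLIT ⟺ not every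
arithmetic member of the family is `p`-locally split modulo `p` (members with wild nebentypus near the boundary of weight space; `p`-old
members never witness it).  Equivalently: the local splitting depth of the members of `H(ρ̄)` through `f_E` has infimum `0`; in Hida's
language (β) says `θ ∉ p𝕀` for his generator `θ` of the unipotent part of `ρ_𝕋(I_p)`.  PRINT RUNG INSIDE U5: for `ρ̄ ≅ Ind_K^ℚ φ̄` with `K` REAL
(image in the normaliser of a split Cartan, `ρ̄(c) ∈ C_s`; `p` splits in `K` automatically) and `f_E` of MINIMAL tame level (`N/p = N(ρ̄)`, no
carrier primes), Hida's Cor 8.4.7 (hypotheses (H0) `p`-distinguished — here `φ̄⁻|_{D_p} = ω ≠ 1` — and (H1) only; NOT (H2), whose local clause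
`φ̄⁻|_{G_p} ≠ ω` FAILS at a multiplicative `p`) gives `θ𝕋 ∩ Λ = (⟨ε⟩ − 1) = (t^{p^{r−1}} − 1)`, `μ = 0`, whence `θ ∉ p𝕀` on EVERY branch
(`𝕀` finite over the normal ring `Λ`): (β) HOLDS there, and the zeros of `θ|_𝕀` lie over the `r` weight-one RM fibres only (= (δ) below, with
no non-classical split points).  [corpus: book:hidand-elementary-modular-iwasawa-theory p.438 (H0–H3), p.441 (Thm 8.3.7, Conj 8.3.8), p.450
(Thm 8.4.3), p.453, p.455 (Prop 8.4.6, Cor 8.4.7), p.458]  OPEN = the crux: carriers present (`f_E` new at primes `ℓ ∤ N(ρ̄)`, the generic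
U5 case: level raising in the `θ`-calculus), `K` imaginary (CM components, (H2) needed in Hida §8.5; heuristically ⟸ `μ(L_p^{−,Katz}) = 0`,
known), and the octahedral image `5S4` (no `[α]`).
THE SECOND INPUT (δ, «vertical fibres»): every `P_τ` vanishes at the `p`-locally split points of `𝕀` — always at the weight-one point `x_h`
(Teichmüller lift of the dihedral/octahedral Artin representation `ρ̄`), whose fibre is LOSSLESS by Greenberg–Vatsal's Artin cotorsion
(Hypothesis A of [GreenbergVatsal2020 = arXiv:1806.05659] is `p ∤ #ρ̄(G_ℚ)`, `d⁺ = 1`: EXACTLY U5; Prop 4.2, Thm 5.1–5.2) [corpus: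
paper:arxiv-1806.05659 p.2–4, p.16, p.21–22]; at CM crossing points by Kato; at NON-classical split points of `𝕀` (if any) — open.
Since every prime factor of `P_τ ∈ 𝕀 ≅ ℤ_p⟦Y⟧` lies inside `(p, Y)` (`P_τ(x_E) = p^a·unit`, `a ≥ 1`), (β)+(δ) are exactly what cancels `P_τ^m`
in the UFD `ℤ_p⟦Y,T⟧` BEFORE specialising at `x_E : Y = 0` (specialising the lossy bound costs `p^{am}`; this is also why «μ does not
specialise naively»: the vertical prime `Y + p` specialises into `(p)`).  The cancelled bound is the genuine two-variable divisibility
`char_{A₂} Sel_𝕋^∨ ∣ L_p^{Ki}`; Ochiai's control (Prop 5.2, `U_I` finite) and base change of characteristic ideals (Lemma 7.2), the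
Greenberg-vs-Bloch–Kato exceptional term at split `p` (one factor `T`), and Kitagawa's interpolation (`L_p^{Ki}(x_E, T) = unit · ϖL_p(E,T)/p^{μ_an}`,
`p`-adic period a unit under (Rk1)) specialise it to the tree's `X11b.MultDivisibilityAt W p` — indeed to `μ(X(E/ℚ_∞)) = 0` as well —, and the
landed door `missingUpperBoundAt_of_classX11a_of_multDivisibilityAt` (finemu5's interface, prints of item 19949 + Greenberg–Stevens) gives U5.

## What is typed here (the tree has no Λ-adic Galois representation, so (β)/(δ) live in the card `Lines/wttransv5.md`; definition request D1)
`TwoVarPackage … D G₁ e` = the SHADOW over `A₂ = (ℤ_p⟦T⟧)⟦Y⟧ = 𝕀⟦Γ⟧` (outer variable `Y` = branch ∕ weight, `x_E : Y = 0`, weight map `X₀ = φ(Y)`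
of ANY degree; inner `T` = cyclotomic) of the pair (`L_p^{Ki}`, `Sel_𝕋^∨`) for a REGULAR branch `𝕀 ≅ ℤ_p⟦Y⟧` (Ochiai's (Nor)): an INTEGRAL `F`
PINNED by value–norm interpolation, at a point `y` of the branch over each admissible weight `k > 2`, of one ordinary newform of level `N/p` (the clause of the tree's `greenbergStevens_kitagawa_twoVariable_interpolation`, read at tame level `N/p`) and by the
weight-2 fibre `p^ν·F(0,T) = u·G₁`, `u ∈ Λ^×`; a finitely generated torsion `A₂`-module `X` CONTROLLED at `Y = 0` by the tree's Selmer dual `D.X`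
(Λ-linear surjection killing `Y·X`, kernel ⊆ finite + `Y·X` + one cyclic `Λ`-line — the Greenberg/Bloch–Kato defect at split `p`) whose
characteristic elements SPECIALISE into `X^e · char_Λ D.X` (`e = 1` at split `p`).  `TwoVarShadowAt W p` = for every cyclotomic datum the
package exists AND `F ∈ char_{A₂} X`.  The pin defeats the one-variable costume (`F := G₁`, `X := D.X⟦Y⟧` needs `char D.X ∣` EVERY
weight-Taylor coefficient of the genuine `F`); without the pin the statement would collapse to `MultDivisibilityAt` (NOTES «cheat analysis»).
rev 2 (g18, 2026-08-29): docstring of `stub_twoVarShadow` carries the (Nor) scope token (critic V#163 P3); statements unchanged.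
Registered stubs (2): `stub_pubFactsAn` (item 19949 BY NAME, shared with finemu5 ∕ hardlocus5) and `stub_twoVarShadow` (THE crux of the line,
beyond print: Ochiai with loss is print; the cancellation (β)+(δ) is new).  Typed scope, said plainly: `F` is `ℤ_p`-valued on a REGULAR branch
`𝕀_E ≅ ℤ_p⟦Y⟧` of any degree over `Λ_wt` (Ochiai's (Nor); Hida, *Elementary Modular Iwasawa Theory* Thm 8.3.7 (1)–(2): in the
real-dihedral minimal case `𝕋 = Λ[Θ]` IS fat, of rank `e ≥ 2`, `≅ W⟦x⟧` when `⟨ε⟩ − 1` is prime; in U5 the level-lowered companion `g` of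
level `N/p` (Ribet: `ρ̄` is finite at `p`) is a second weight-2 point of `𝐡_𝔪`) — a NON-regular branch, or one with residue ring bigger
than `ℤ_p`, needs the `𝕀`-adic re-typing (definition request D1: the Λ-adic Galois representation of a branch).
-/

-- D-0017: single-problem summit, so `Summit.BirchSwinnertonDyer.BirchSwinnertonDyer.…` repeats a namespace BY DESIGN.
set_option linter.dupNamespace false
set_option autoImplicit false

noncomputable section

open scoped Classical MatrixGroups ModularForm

open CongruenceSubgroup WeierstrassCurve
  Literature.NumberTheory.EllipticCurves
  Literature.NumberTheory.EllipticCurves.ModularForms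
  Literature.NumberTheory.EllipticCurves.Rank1Residual
  Literature.NumberTheory.EllipticCurves.Rank1Residual.Typed
  Literature.NumberTheory.EllipticCurves.SteinWuthrich2013
  Literature.NumberTheory.EllipticCurves.Greenberg1999
  Summit.BirchSwinnertonDyer.Rank1Residual
  Summit.BirchSwinnertonDyer.Rank1Residual.X11b
  Summit.BirchSwinnertonDyer.BirchSwinnertonDyer

namespace Summit.BirchSwinnertonDyer.BirchSwinnertonDyer.Cruxes.UpperNonSurjFive.WtTransv

variable {p : ℕ} [Fact p.Prime]

/-- `φ(u) = Σ' aₙ uⁿ ∈ ℚ̄_p` for `φ ∈ ℤ_p⟦Y⟧` and `u ∈ ℚ̄_p` (a `tsum` in Mathlib's normed field `PadicAlgCl p = ℚ̄_p`; for `‖u‖ < 1`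
algebraic the partial sums live in the complete field `ℚ_p(u)`, so this is the genuine value). Used to locate the arithmetic points of a
branch `𝕀 ≅ ℤ_p⟦Y⟧` of degree `e ≥ 1` over the weight algebra `ℤ_p⟦X₀⟧`, `X₀ ↦ φ(Y)`: the weight-`k` points of `𝕀` are the `y` with
`φ(y) = (1+p)^{k-2} - 1`, in general in extensions of `ℚ_p` of degree `≤ e`. [folklore] -/
def evalCl (φ : PowerSeries ℤ_[p]) (u : PadicAlgCl p) : PadicAlgCl p :=
  ∑' n : ℕ, algebraMap ℚ_[p] (PadicAlgCl p) ((PowerSeries.coeff n φ : ℤ_[p]) : ℚ_[p]) * u ^ n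

/-- `F(u, v) = Σ' a_{ij} uⁱ vʲ ∈ ℚ̄_p` for `F ∈ (ℤ_p⟦T⟧)⟦Y⟧` (OUTER variable `Y` = the branch ∕ weight variable, evaluated at `u`; INNER
variable `T` = the cyclotomic variable, evaluated at `v`), a `tsum` over `Fin 2 →₀ ℕ` in `ℚ̄_p` (cf. the tree's `padicEval₂` over `ℚ_p`). [folklore] -/
def evalCl₂ (F : PowerSeries (IwasawaAlgebra p)) (u v : PadicAlgCl p) : PadicAlgCl p :=
  ∑' d : Fin 2 →₀ ℕ,
    algebraMap ℚ_[p] (PadicAlgCl p) ((PowerSeries.coeff (d 1) (PowerSeries.coeff (d 0) F) : ℤ_[p]) : ℚ_[p]) * (u ^ d 0 * v ^ d 1)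

/-- **The interpolation pin** (value–norm form, ONE member per admissible weight, on a branch `𝕀 ≅ ℤ_p⟦Y⟧` of ANY degree over the
weight algebra, `X₀ = φ(Y)`): for every `k > 2`, `k ≡ 2 (mod p−1)`, SOME point `y ∈ ℚ̄_p`, `‖y‖ < 1`, `φ(y) = (1+p)^{k−2} − 1`, and SOME ordinary
newform `g` of weight `k` and level `M`, `M·p = N`, congruent to `E` away from `N`, with unit root `α ≡ a_p(E)`, a `p`-adic period `Ω ≠ 0`
and a complex period `ω ≠ 0`, has its critical values `Λ(g,n)` (`n` odd, `0 < n`, `2n < k`, `(p−1) ∣ (n−1)`) interpolated by `F` at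
`(y, y_n)`, `y_n = (1+p)^{n−1} − 1`, up to the Euler factor `(1 − p^{n−1}/α)(1 − p^{k−1−n}/α)` (`α ≡ a_p(E) = +1` at
split, `−1` at non-split multiplicative `p` — NOT the tree's `frobeniusTrace`, which is `1 + a_p` at a bad prime) — the clause (interp) of
`Literature.NumberTheory.EllipticCurves.greenbergStevens_kitagawa_twoVariable_interpolation` read for the branch through a `p`-NEW weight-2
point (tame level `N/p`: the weight-`k > 2` members are `p`-stabilised newforms of level `N/p`), existentially in the member (other branches of
`𝐡_𝔪` carry other congruent members). [cite: GreenbergStevens1993, Thm 5.15] [cite: Kitagawa1994, Thm 1.1] [cite: Delbourgo2008, Thm 4.11, Def 4.12]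
[cite: Ochiai2006, Thm 6.7 and Cor 6.17] -/
def InterpolatesBranch (W : WeierstrassCurve ℚ) [W.IsElliptic] [W.IsGloballyMinimal] (p : ℕ) [Fact p.Prime]
    (φ : PowerSeries ℤ_[p]) (F : PowerSeries (IwasawaAlgebra p)) : Prop :=
  ∀ k : ℤ, 2 < k → ((p : ℤ) - 1) ∣ (k - 2) →
    ∃ (y : PadicAlgCl p) (M : ℕ) (_ : NeZero M) (g : CuspForm (Gamma0 M) k) (ι : coeffField g →+* PadicAlgCl p)
      (Ω α : PadicAlgCl p) (ω : ℂ),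
      ‖y‖ < 1 ∧ evalCl φ y = algebraMap ℚ_[p] (PadicAlgCl p) ((1 + (p : ℚ_[p])) ^ (k - 2) - 1) ∧
      M * p = W.conductorNorm ℤ ∧ IsNewform0 g ∧
      ‖ι ⟨(UpperHalfPlane.qExpansion 1 ⇑g).coeff p, coeff_mem_coeffField g p⟩‖ = 1 ∧
      (∀ ℓ : ℕ, ℓ.Prime → ¬ ℓ ∣ W.conductorNorm ℤ →
        ‖ι ⟨(UpperHalfPlane.qExpansion 1 ⇑g).coeff ℓ, coeff_mem_coeffField g ℓ⟩ -
          ((W.frobeniusTrace ℓ : ℤ) : PadicAlgCl p)‖ < 1) ∧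
      Ω ≠ 0 ∧ ω ≠ 0 ∧ ‖α‖ = 1 ∧
      α ^ 2 - ι ⟨(UpperHalfPlane.qExpansion 1 ⇑g).coeff p, coeff_mem_coeffField g p⟩ * α +
        (p : PadicAlgCl p) ^ (k - 1).toNat = 0 ∧
      (W.HasSplitMultiplicativeReductionAtPrime p → ‖α - 1‖ < 1) ∧
      (¬ W.HasSplitMultiplicativeReductionAtPrime p → ‖α + 1‖ < 1) ∧
      ∀ n : ℕ, 0 < n → 2 * (n : ℤ) < k → Odd n → (p - 1) ∣ (n - 1) →
        ∃ hmem : Complex.I ^ n * completedLValue g n / ω ∈ coeffField g,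
          ‖evalCl₂ F y (algebraMap ℚ_[p] (PadicAlgCl p) ((1 + (p : ℚ_[p])) ^ (n - 1) - 1))‖ =
            ‖Ω‖ * ‖(1 - (p : PadicAlgCl p) ^ (n - 1) / α) * (1 - (p : PadicAlgCl p) ^ ((k - 1).toNat - n) / α)‖ *
              ‖ι ⟨_, hmem⟩‖

/-- **The two-variable package** over `A₂ = (ℤ_p⟦T⟧)⟦Y⟧ = 𝕀⟦Γ⟧` attached to a cyclotomic Selmer-dual datum `D`, an integral one-variable
element `G₁` (meant: `ι G₁ = ϖ · L_p(E,T)`) and the exceptional exponent `e` (`0` non-split, `1` split): the typed shadow of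
(Kitagawa's `L_p^{Ki}`, Ochiai's `Sel_𝕋^∨`) for a REGULAR branch `𝕀 ≅ ℤ_p⟦Y⟧` (Ochiai's (Nor); any degree over the weight algebra,
`X₀ = φ(Y)` — Hida, Thm 8.3.7 (1): `𝕋 ≅ W⟦x⟧` of rank `e ≥ 2` in the real-dihedral case).  Fields: `F` pinned by `InterpolatesBranch` and by the weight-2 fibre
`p^ν · F(0,T) = u · G₁`, `u` a unit (Kitagawa: `p`-adic period a unit, `ν = μ_an`); `X` finitely generated torsion; `ctrl` = control at
`Y = 0` onto `D.X` (Λ-linear through the inner variable, kills `Y·X`, kernel ⊆ finite + `Y·X` + one cyclic Λ-line: Ochiai Prop 5.2 with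
`U_I` finite, plus the Greenberg/Bloch–Kato defect `≅ ℤ_p` at split `p`); `spec` = characteristic elements specialise into
`X^e · char_Λ D.X` (Ochiai Lemma 7.2 + the exceptional factor). Nothing asserted. [cite: Ochiai2006, Prop 5.2, Lemma 7.2, Cor 7.5]
[cite: Kitagawa1994, Thm 1.1] [cite: Greenberg1999, Thm 1.5 (split multiplicative defect)] -/
structure TwoVarPackage (W : WeierstrassCurve ℚ) [W.IsElliptic] [W.IsGloballyMinimal] (p : ℕ) [Fact p.Prime]
    {κ : ZpExtension ℚ p} {γ : Field.absoluteGaloisGroup ℚ} (D : W.SelmerDualData κ γ)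
    (G₁ : IwasawaAlgebra p) (e : ℕ) where
  /-- The weight map `X₀ ↦ φ(Y)` of the branch `𝕀 ≅ ℤ_p⟦Y⟧` (degree `e ≥ 1` over `ℤ_p⟦X₀⟧`; `φ(0) = 0`: `Y = 0` is the point `x_E`). -/
  wtMap : PowerSeries ℤ_[p]
  /-- `Y = 0` lies over the weight-2 point `X₀ = 0`. -/
  wtMap_zero : PowerSeries.constantCoeff wtMap = 0
  /-- The integral two-variable `p`-adic `L`-function of the branch, in the variables `(Y, T)`. -/
  F : PowerSeries (IwasawaAlgebra p)
  /-- Value–norm interpolation of one member per admissible weight at a point of the branch over it. -/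
  interp : InterpolatesBranch W p wtMap F
  /-- Weight-2 fibre: `p^ν F(0,T) = u G₁`, `u ∈ Λ^×`. -/
  wt2 : ∃ (u : IwasawaAlgebra p) (ν : ℕ), IsUnit u ∧
    PowerSeries.C ((p : ℤ_[p]) ^ ν : ℤ_[p]) * PowerSeries.constantCoeff F = u * G₁
  /-- The two-variable Selmer dual (shadow). -/
  X : Type
  /-- `X` is an abelian group. -/
  [addCommGroup : AddCommGroup X]
  /-- `X` is an `A₂`-module. -/
  [module : Module (PowerSeries (IwasawaAlgebra p)) X]
  /-- `X` is finitely generated. -/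
  finite : Module.Finite (PowerSeries (IwasawaAlgebra p)) X
  /-- `X` is torsion. -/
  torsion : Module.IsTorsion (PowerSeries (IwasawaAlgebra p)) X
  /-- Control at the weight-2 point `x_E : Y = 0`. -/
  ctrl : X →+ D.X
  /-- `ctrl` is `Λ`-linear through the inner (cyclotomic) variable. -/
  ctrl_C_smul : ∀ (r : IwasawaAlgebra p) (x : X), ctrl ((PowerSeries.C r : PowerSeries (IwasawaAlgebra p)) • x) = r • ctrl x
  /-- `ctrl` kills `Y · X` (`PowerSeries.X` = the outer variable `Y`). -/
  ctrl_X_smul : ∀ x : X, ctrl ((PowerSeries.X : PowerSeries (IwasawaAlgebra p)) • x) = 0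
  /-- `ctrl` is onto. -/
  ctrl_surjective : Function.Surjective ctrl
  /-- `ker ctrl ⊆ finite + Y·X + Λ·z`. -/
  ctrl_ker : ∃ (S : Finset X) (z : X), ∀ x : X, ctrl x = 0 →
    ∃ s ∈ S, ∃ (y : X) (r : IwasawaAlgebra p),
      x = s + (PowerSeries.X : PowerSeries (IwasawaAlgebra p)) • y + (PowerSeries.C r : PowerSeries (IwasawaAlgebra p)) • z
  /-- Characteristic elements specialise into `X^e · char_Λ D.X`. -/
  spec : ∀ c ∈ Module.charIdeal (PowerSeries (IwasawaAlgebra p)) X,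
    PowerSeries.constantCoeff c ∈ Ideal.span {(PowerSeries.X : IwasawaAlgebra p) ^ e} * D.charIdeal

attribute [instance] TwoVarPackage.addCommGroup TwoVarPackage.module

/-- **`TwoVarShadowAt W p` — the typed two-variable divisibility at the pair** (the conclusion of the line's mechanism, in the shape the
door consumes): for every cyclotomic datum `(κ, γ)`, newform `f` of `E`, Selmer-dual datum `D` and period ratio `ϖ`: for THE multiplicative
`p`-adic `L`-function `L` of `f` there are an integral `G₁` with `ι G₁ = ϖ · L` and a `TwoVarPackage` for `(D, G₁, e)` whose `F` lies in
`char_{A₂} X` (`e = 0` at non-split `p`, `e = 1` at split `p`). Nothing asserted. [cite: Ochiai2006, Conj 2.4 and Thm 2] -/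
def TwoVarShadowAt (W : WeierstrassCurve ℚ) [W.IsElliptic] [W.IsGloballyMinimal] (p : ℕ) [Fact p.Prime] : Prop :=
  ∀ {κ : ZpExtension ℚ p} {γ : Field.absoluteGaloisGroup ℚ} {N : ℕ} [NeZero N] {f : CuspForm (Gamma0 N) 2},
    κ.IsCyclotomic → κ.IsTopGenerator γ → IsCyclotomicVariable p γ → IsNewformOf W f →
    ∀ (D : W.SelmerDualData κ γ) (ϖ : ℚ), ϖ ≠ 0 → (ϖ : ℝ) * W.realPeriodRat = plusPeriod f →
      (¬ W.HasSplitMultiplicativeReductionAtPrime p →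
        ∀ L : PowerSeries ℚ_[p], IsMultPAdicLFunctionOf f p (-1) L →
          ∃ (G₁ : IwasawaAlgebra p) (P : TwoVarPackage W p D G₁ 0),
            iwasawaToPowerSeries p G₁ = PowerSeries.C ((ϖ : ℚ) : ℚ_[p]) * L ∧
            P.F ∈ Module.charIdeal (PowerSeries (IwasawaAlgebra p)) P.X) ∧
      (W.HasSplitMultiplicativeReductionAtPrime p →
        ∀ L : PowerSeries ℚ_[p], IsSplitMultPAdicLFunctionOf f p L →
          ∃ (G₁ : IwasawaAlgebra p) (P : TwoVarPackage W p D G₁ 1),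
            iwasawaToPowerSeries p G₁ = PowerSeries.C ((ϖ : ℚ) : ℚ_[p]) * L ∧
            P.F ∈ Module.charIdeal (PowerSeries (IwasawaAlgebra p)) P.X)

/-! ### The two registered stubs -/

/-- **stub (published inputs; item 19949 BY NAME, shared with finemu5/hardlocus5)**: the conjunction of the named published facts
(Gross–Zagier–Kolyvagin, modularity, parametrisation, Stein–Wuthrich 6.1 split/non-split, Greenberg–Stevens, Kato 12.4 and the
multiplicative §17.13 inputs, Greenberg 1999 Thm 1.5, Wuthrich 2014 Cor 18, …).
[cite: Kato2004Asterisque, Thm. 12.4 (p. 221)] [cite: SteinWuthrich2013, Thm. 6.1 (p. 20)] -/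
theorem stub_pubFactsAn : Theses.ErratumRoadFive.KatoTwinFactsFiveAn := by
  sorry

/-- **stub (THE crux of the line; beyond print; LOAD-BEARING)**: at every X11a pair with `ρ̄_{E,p}` not surjective and `p ≥ 5` the typed
two-variable divisibility `TwoVarShadowAt W p` holds.  Route to it: Ochiai's two-variable Euler-system bound with unipotent loss `P_τ^m`
(print, modulo branch regularity) + (β) corner unit `π ∤ P_τ` (the mod-`p` Hida family is non-split at `p`) + (δ) losslessness at the
vertical fibres through the common zeros of the `P_τ` (weight one: Greenberg–Vatsal; non-classical split points: open) + UFD cancellation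
+ Ochiai control/specialisation + Kitagawa's unit period.  Why it might fail: (β) false for a U5 family all of whose members are `p`-split
mod `p`; a non-classical `p`-split point of `𝕀_E` carrying Selmer corank; a fat branch (`F` not `ℤ_p`-valued).
TYPED MODULO (Nor) (rev 2, critic V#163 P3): the `∀` ranges over ALL of U5, but `TwoVarShadowAt` packages a REGULAR branch
`𝕀_E ≅ ℤ_p⟦Y⟧` with residue ring `ℤ_p` (Ochiai's standing hypothesis `ℍ ≅ 𝒪⟦X₁,X₂⟧` with `𝒪 = ℤ_p`); a U5 pair whose Hida branch is
SINGULAR at `x_E` (thick congruence with the level-lowered companion of level `N/p`) or has residue ring `≠ ℤ_p` FALSIFIES THIS STUB AS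
TYPED without touching the mechanism — re-typing it for a general branch is definition request D1 (Λ-adic representation of a branch
of `𝐡^{ord}`, its `P_τ` and `θ`).  No known U5 pair has (β) in print (habitat census, card §Idea): the stub is beyond print on the whole census.
[cite: Ochiai2006, Thm 2, Thm 3 (ii), Prop 5.2, Lemma 7.2, Cor 7.5] [cite: GreenbergVatsal2020, Prop 4.2, Thm 5.2] [cite: Kitagawa1994, Thm 1.1] -/
theorem stub_twoVarShadow :
    ∀ (W : WeierstrassCurve ℚ) [W.IsElliptic] [W.IsGloballyMinimal] (p : ℕ) [Fact p.Prime],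
      ClassX11a W p → ¬ Surj W p → 5 ≤ p → TwoVarShadowAt W p := by
  sorry

/-! ### Specialisation algebra (real proofs) and the composition -/

/-- From a package with `F ∈ char X`: `G₁ ∈ X^e · char_Λ D.X`. [folklore] -/
theorem mem_pow_mul_charIdeal_of_package {W : WeierstrassCurve ℚ} [W.IsElliptic] [W.IsGloballyMinimal]
    {κ : ZpExtension ℚ p} {γ : Field.absoluteGaloisGroup ℚ} {D : W.SelmerDualData κ γ}
    {G₁ : IwasawaAlgebra p} {e : ℕ} (P : TwoVarPackage W p D G₁ e)
    (hF : P.F ∈ Module.charIdeal (PowerSeries (IwasawaAlgebra p)) P.X) :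
    G₁ ∈ Ideal.span {(PowerSeries.X : IwasawaAlgebra p) ^ e} * D.charIdeal := by
  obtain ⟨u, ν, hu, hwt⟩ := P.wt2
  have h0 : PowerSeries.constantCoeff P.F ∈
      Ideal.span {(PowerSeries.X : IwasawaAlgebra p) ^ e} * D.charIdeal := P.spec _ hF
  have h1 : u * G₁ ∈ Ideal.span {(PowerSeries.X : IwasawaAlgebra p) ^ e} * D.charIdeal := by
    rw [← hwt]
    exact Ideal.mul_mem_left _ _ h0
  obtain ⟨v, hv⟩ := hu
  have h2 : (↑v⁻¹ : IwasawaAlgebra p) * (u * G₁) ∈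
      Ideal.span {(PowerSeries.X : IwasawaAlgebra p) ^ e} * D.charIdeal := Ideal.mul_mem_left _ _ h1
  have h3 : (↑v⁻¹ : IwasawaAlgebra p) * (u * G₁) = G₁ := by
    rw [← mul_assoc, ← hv, Units.inv_mul, one_mul]
  rwa [h3] at h2

/-- **Specialisation** (real proof): `TwoVarShadowAt W p` + Kato's torsion (print, `thm15_isTorsion_multiplicative_rat`) ⟹
`X11b.MultDivisibilityAt W p`. [folklore] -/
theorem multDivisibilityAt_of_twoVarShadow (h15 : thm15_isTorsion_multiplicative_rat)
    (W : WeierstrassCurve ℚ) [W.IsElliptic] [W.IsGloballyMinimal] (p : ℕ) [Fact p.Prime]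
    (hmult : Mult W p) (hsh : TwoVarShadowAt W p) : MultDivisibilityAt W p := by
  intro κ γ N _ f hκ hγ hγ' hf D ϖ hϖ0 hϖ
  obtain ⟨hns, hsp⟩ := hsh hκ hγ hγ' hf D ϖ hϖ0 hϖ
  refine ⟨h15 W p hmult f hf κ γ hκ hγ D, ?_, ?_⟩
  · intro hnsplit L hL
    obtain ⟨G₁, P, hι, hF⟩ := hns hnsplit L hL
    have hmem := mem_pow_mul_charIdeal_of_package P hF
    rw [pow_zero, Ideal.span_singleton_one, Ideal.top_mul] at hmem
    exact ⟨G₁, hmem, hι⟩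
  · intro hsplit L hL
    obtain ⟨G₁, P, hι, hF⟩ := hsp hsplit L hL
    have hmem := mem_pow_mul_charIdeal_of_package P hF
    rw [pow_one, Ideal.mem_span_singleton_mul] at hmem
    obtain ⟨g, hg, hgX⟩ := hmem
    exact ⟨g, hg, by rw [← hι, ← hgX]⟩

/-- **Composition (real proof; both stubs applied BY NAME), concluding the crux BY NAME**: `stub_twoVarShadow` ⟹
(`multDivisibilityAt_of_twoVarShadow`, torsion from the print `h15` of `stub_pubFactsAn`) `MultDivisibilityAt` ⟹ (landed door
`missingUpperBoundAt_of_classX11a_of_multDivisibilityAt`, fed the prints of `stub_pubFactsAn`) `PrintX11a.UpperNonSurjFive`.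
[cite: Kato2004Asterisque, §17.13 (pp. 279–280)] [cite: SteinWuthrich2013, Thm. 6.1 (p. 20)] -/
theorem UpperNonSurjFive_of_wttransv : Theses.PrintX11a.UpperNonSurjFive := by
  obtain ⟨-, -, -, hGZK, hmod, -, hpar, -, -, -, -, hJs, hJn, hGS, -, -, -, -, -, -, h15, -, -⟩ := stub_pubFactsAn
  intro W _ _ p _ hX hns hp5
  exact missingUpperBoundAt_of_classX11a_of_multDivisibilityAt hJs hJn hGZK hmod hpar W p (hGS W p) hX
    (multDivisibilityAt_of_twoVarShadow h15 W p hX.2.2.1 (stub_twoVarShadow W p hX hns hp5))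

end Summit.BirchSwinnertonDyer.BirchSwinnertonDyer.Cruxes.UpperNonSurjFive.WtTransv

end
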